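import Literature.Barriers.CriticalPhenomena.SupercriticalSAWSpaceFillingDichotomy
import Mathlib.Algebra.Order.Field.GeomSum
import Mathlib.Analysis.SpecialFunctions.Log.Basic
import HarnessLib

/-!
# Supercritical self-avoiding walks are space-filling (Duminil-Copin–Kozma–Yadin 2014):
# estimates for the Peierls sum (endpoints, weights to laws, counting, geometric tail)

Fifth file of the proof of Theorem 6 of H. Duminil-Copin, G. Kozma, A. Yadin, *Supercritical
self-avoiding walks are space-filling*, Ann. IHP Probab. Stat. 50 (2014) 315–326
(arXiv:1110.3074) for `Ω = 𝔻` (`DKY2014_thm6_disk`; the sum itself is `…Peierls.lean`).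
Elementary inputs of the assembly:

* the endpoints: a closest site `a_δ` to a boundary point of the disk satisfies
  `(1/δ - 3)² ≤ ‖a_δ‖²` (`sq_le_sum_sq_of_isClosestSite`, from `IsClosestSite.dist_le`), is near
  the outside of `𝔻_δ` (`nearOutside_of_isClosestSite`: five steps outwards in the larger
  coordinate leave the disk), and `a_δ, b_δ` are `≥ Λ` apart in some coordinate once
  `(2Λ+6)δ ≤ |a-b|` (`exists_le_abs_sub_of_isClosestSite`);
* probabilities from weights: `lawAt_le_of_weightAt_le` (`P(A) ≤ B` from `weight(A) ≤ B·Z`; the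
  junk cases `Z ∈ {0, ∞}` of `lawAt` give `0`) and the division step `le_of_mul_ofReal_le` for
  the multiplicative form of Proposition 7;
* counting: `(2⌈1/δ⌉+1)² ≤ 25/δ²` (`ceil_sq_le`), so at most `25/δ²` deep boxes
  (`card_deepBoxes_le`, the printed `C(Ω)/δ²`);
* the geometric tail `Σ_{K ≥ ⌊s/C₃⌋+1} 25^{K-1}·4·C₇x⁸/q^K ≤ (8C₇x⁸/25) e^{-(log 2/C₃)s}` for
  `q ≥ 100` (`peierls_tail_le`, the printed "`Σ_{i ≥ s/(2m+1)²} (λ/Z_m(x))^i ≤ … 2^{-s/(2m+1)²}`"),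
  and the bookkeeping of the final constant (`final_constant_le`).
-/

noncomputable section

open MeasureTheory Literature.Probability.LatticeModels Literature.Probability.Percolation
  Literature.Probability.RandomPlanarGeometry.SAW
open scoped ENNReal

namespace Literature.Barriers.CriticalPhenomena

namespace SupercriticalSAW

variable {δ : ℝ} {u v : Site 2}

/-! ### The endpoints `a_δ, b_δ`: in `𝔻_δ`, near its outside, and far apart -/

/-- `x_c = 1/μ ≥ 0` (`μ` is an infimum of nonnegative reals). [folklore] -/
theorem criticalFugacity_nonneg : 0 ≤ criticalFugacity := by
  rw [criticalFugacity, inv_nonneg, connectiveConstant]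
  exact Real.iInf_nonneg fun n => Real.rpow_nonneg (Nat.cast_nonneg _) _

/-- `meshPoint` is additive: `δ(u - v) = δu - δv`. [folklore] -/
theorem meshPoint_sub (δ : ℝ) (u v : Site 2) :
    meshPoint δ (u - v) = meshPoint δ u - meshPoint δ v := by
  apply Complex.ext
  · simp only [meshPoint_re, Complex.sub_re, Pi.sub_apply, Int.cast_sub]; ring
  · simp only [meshPoint_im, Complex.sub_im, Pi.sub_apply, Int.cast_sub]; ring

/-- A closest site `a_δ` to a boundary point of the disk has `‖a_δ‖ ≥ 1/δ - 3` in lattice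
units: `(1/δ - 3)² ≤ (a_δ)₀² + (a_δ)₁²` (for `0 < δ ≤ 1/4`). [cite: DuminilCopinKozmaYadin2014, §1 (a_δ, b_δ)] -/
theorem sq_le_sum_sq_of_isClosestSite (hδ : 0 < δ) (hδ' : δ ≤ 1 / 4) {a : ℂ} (ha : ‖a‖ = 1)
    (hu : IsClosestSite unitDisk δ a u) : (1 / δ - 3) ^ 2 ≤ ∑ j, ((u j : ℤ) : ℝ) ^ 2 := by
  have hdist := hu.dist_le hδ hδ' ha
  have hnorm : 1 - 3 * δ ≤ ‖meshPoint δ u‖ := by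
    have := norm_sub_norm_le a (meshPoint δ u)
    rw [ha, ← dist_eq_norm, dist_comm] at this
    linarith
  have hsq : (1 - 3 * δ) ^ 2 ≤ δ ^ 2 * ∑ j, ((u j : ℤ) : ℝ) ^ 2 := by
    rw [← norm_meshPoint_sq]
    exact pow_le_pow_left₀ (by linarith) hnorm 2
  have h1 : (1 / δ - 3) ^ 2 = (1 - 3 * δ) ^ 2 / δ ^ 2 := by
    field_simp
  rw [h1, div_le_iff₀ (by positivity)]
  linarith

/-- **The closest sites are near the outside of `𝔻_δ`**: moving `a_δ` five steps outwards in
its larger coordinate leaves the disk (`0 < δ ≤ 1/4`). [cite: DuminilCopinKozmaYadin2014, §1 (a_δ, b_δ)] -/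
theorem nearOutside_of_isClosestSite (hδ : 0 < δ) (hδ' : δ ≤ 1 / 4) {a : ℂ} (ha : ‖a‖ = 1)
    (hu : IsClosestSite unitDisk δ a u) : NearOutside δ u := by
  have hT := sq_le_sum_sq_of_isClosestSite hδ hδ' ha hu
  rw [Fin.sum_univ_two] at hT
  -- the larger coordinate
  obtain ⟨i, hi⟩ : ∃ i : Fin 2, ∀ j, |u j| ≤ |u i| := by
    by_cases h01 : |u 0| ≤ |u 1|
    · exact ⟨1, fun j => by fin_cases j <;> simp [h01]⟩
    · exact ⟨0, fun j => by fin_cases j <;> simp [(not_le.1 h01).le]⟩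
  set e : ℤ := if 0 ≤ u i then 5 else -5 with he
  refine ⟨Function.update u i (u i + e), fun hmem => ?_, fun j => ?_⟩
  · -- the moved site is outside the disk
    rw [mem_meshDomain_unitDisk_iff_lt_sq hδ, Fin.sum_univ_two] at hmem
    set ρ : ℝ := 1 / δ with hρ
    have hρ4 : 4 ≤ ρ := by
      rw [hρ, le_div_iff₀ hδ]; linarith
    -- `T = u₀² + u₁²`, `A = |u i|`
    set T : ℝ := ((u 0 : ℤ) : ℝ) ^ 2 + ((u 1 : ℤ) : ℝ) ^ 2 with hTdef
    set A : ℝ := |((u i : ℤ) : ℝ)| with hA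
    have hA0 : 0 ≤ A := abs_nonneg _
    have hAT : T ≤ 2 * A ^ 2 := by
      have h0 : |((u 0 : ℤ) : ℝ)| ≤ A := by rw [hA]; exact_mod_cast hi 0
      have h1 : |((u 1 : ℤ) : ℝ)| ≤ A := by rw [hA]; exact_mod_cast hi 1
      have e0 : ((u 0 : ℤ) : ℝ) ^ 2 ≤ A ^ 2 := by
        rw [← sq_abs]; exact pow_le_pow_left₀ (abs_nonneg _) h0 2
      have e1 : ((u 1 : ℤ) : ℝ) ^ 2 ≤ A ^ 2 := by
        rw [← sq_abs]; exact pow_le_pow_left₀ (abs_nonneg _) h1 2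
      linarith
    -- the sum of squares of the moved site is `T + 10 A + 25`
    have hsum : ((Function.update u i (u i + e) 0 : ℤ) : ℝ) ^ 2 +
        ((Function.update u i (u i + e) 1 : ℤ) : ℝ) ^ 2 = T + 10 * A + 25 := by
      have hAi : (((u i + e : ℤ)) : ℝ) ^ 2 = ((u i : ℤ) : ℝ) ^ 2 + 10 * A + 25 := by
        rw [hA, he]
        split_ifs with h
        · rw [abs_of_nonneg (by exact_mod_cast h)]; push_cast; ring
        · rw [abs_of_neg (by exact_mod_cast (not_le.1 h))]; push_cast; ring
      fin_cases i
      · simp only [Fin.zero_eta, Fin.isValue, Function.update_self, ne_eq, one_ne_zero,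
          not_false_eq_true, Function.update_of_ne] at hAi ⊢
        rw [hAi]; ring
      · simp only [Fin.mk_one, Fin.isValue, Function.update_self, ne_eq, zero_ne_one,
          not_false_eq_true, Function.update_of_ne] at hAi ⊢
        rw [hAi]; ring
    rw [hsum] at hmem
    -- `10 A ≥ 7 (ρ - 3)` and `T ≥ (ρ - 3)²` contradict `T + 10 A + 25 < ρ²`
    have h7 : 7 * (ρ - 3) ≤ 10 * A := by nlinarith
    nlinarith
  · by_cases hj : j = i
    · subst hj; simp only [Function.update_self, he]; split_ifs <;> simp
    · simp [Function.update_of_ne hj]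

/-- **The closest sites are far apart in some coordinate** once `(2Λ + 6) δ ≤ |a - b|`
(`0 < δ ≤ 1/4`). [cite: DuminilCopinKozmaYadin2014, §1 (a_δ, b_δ)] -/
theorem exists_le_abs_sub_of_isClosestSite (hδ : 0 < δ) (hδ' : δ ≤ 1 / 4) {a b : ℂ}
    (ha : ‖a‖ = 1) (hb : ‖b‖ = 1) (hu : IsClosestSite unitDisk δ a u)
    (hv : IsClosestSite unitDisk δ b v) {Λ : ℕ} (hΛ : (2 * Λ + 6) * δ ≤ ‖a - b‖) :
    ∃ i, (Λ : ℤ) ≤ |u i - v i| := by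
  by_contra hcon
  push Not at hcon
  have hsum : ∑ j, (((u - v) j : ℤ) : ℝ) ^ 2 < 2 * (Λ : ℝ) ^ 2 := by
    rw [Fin.sum_univ_two]
    have key : ∀ j, (((u - v) j : ℤ) : ℝ) ^ 2 < (Λ : ℝ) ^ 2 := by
      intro j
      have h1 : |((u j - v j : ℤ) : ℝ)| < (Λ : ℝ) := by exact_mod_cast hcon j
      have h2 := abs_nonneg (((u j - v j : ℤ)) : ℝ)
      rw [Pi.sub_apply, ← sq_abs]
      exact pow_lt_pow_left₀ h1 h2 two_ne_zero
    linarith [key 0, key 1]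
  have hnorm : ‖a - b‖ - 6 * δ ≤ ‖meshPoint δ (u - v)‖ := by
    rw [meshPoint_sub]
    have h1 := hu.dist_le hδ hδ' ha
    have h2 := hv.dist_le hδ hδ' hb
    rw [dist_eq_norm] at h1 h2
    have h3 : ‖(meshPoint δ u - meshPoint δ v) - (a - b)‖ ≤ 6 * δ := by
      calc ‖(meshPoint δ u - meshPoint δ v) - (a - b)‖ = ‖(meshPoint δ u - a) - (meshPoint δ v - b)‖ := by
            congr 1; ring
        _ ≤ ‖meshPoint δ u - a‖ + ‖meshPoint δ v - b‖ := norm_sub_le _ _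
        _ ≤ 6 * δ := by linarith
    have h5 : ‖(a - b) - (meshPoint δ u - meshPoint δ v)‖ ≤ 6 * δ := by rw [norm_sub_rev]; exact h3
    have h6 := norm_sub_norm_le (a - b) ((a - b) - (meshPoint δ u - meshPoint δ v))
    rw [sub_sub_cancel] at h6
    linarith
  have hsq : (‖a - b‖ - 6 * δ) ^ 2 ≤ δ ^ 2 * ∑ j, (((u - v) j : ℤ) : ℝ) ^ 2 := by
    rw [← norm_meshPoint_sq]
    exact pow_le_pow_left₀ (by nlinarith) hnorm 2
  have h4 : (2 * Λ * δ) ^ 2 ≤ (‖a - b‖ - 6 * δ) ^ 2 :=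
    pow_le_pow_left₀ (by positivity) (by linarith) 2
  nlinarith [sq_nonneg δ, mul_pos hδ hδ]

/-! ### From weights to the law -/

/-- `P(A) ≤ B` from `weight(A) ≤ B · Z` (in the junk cases `Z = 0` or `Z = ∞` the law is `0`).
[cite: DuminilCopinKozmaYadin2014, §1 (definition of P_{(Ω_δ,a_δ,b_δ,x)})] -/
theorem lawAt_le_of_weightAt_le {Ω : Set ℂ} {a b : Site 2} {x : ℝ} {S : Set (DomainSAW Ω δ a b)}
    {B : ℝ≥0∞} (h : weightAt x Ω δ a b S ≤ B * weightAt x Ω δ a b Set.univ) :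
    lawAt x Ω δ a b S ≤ B := by
  rw [lawAt, Measure.smul_apply, smul_eq_mul]
  set Z := weightAt x Ω δ a b Set.univ with hZ
  rcases eq_or_ne Z 0 with h0 | h0
  · have : weightAt x Ω δ a b S = 0 := measure_mono_null (Set.subset_univ _) h0
    rw [this, mul_zero]; exact zero_le
  rcases eq_or_ne Z ⊤ with htop | htop
  · rw [htop, ENNReal.inv_top, zero_mul]; exact zero_le
  calc Z⁻¹ * weightAt x Ω δ a b S ≤ Z⁻¹ * (B * Z) := by gcongr
    _ = B := by rw [mul_comm B, ← mul_assoc, ENNReal.inv_mul_cancel h0 htop, one_mul]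

/-- Division step for the multiplicative form of Proposition 7: from `w · Z_F ≤ C · Z` and
`Z_F ≥ f > 0`, `w ≤ (C/f) · Z`. [folklore] -/
theorem le_of_mul_ofReal_le {w Z : ℝ≥0∞} {ZF C f : ℝ} (hf : 0 < f) (hfZ : f ≤ ZF) (hC : 0 ≤ C)
    (h : w * ENNReal.ofReal ZF ≤ ENNReal.ofReal C * Z) : w ≤ ENNReal.ofReal (C / f) * Z := by
  have hZF : 0 < ZF := hf.trans_le hfZ
  have h1 : w ≤ ENNReal.ofReal C * Z * (ENNReal.ofReal ZF)⁻¹ := by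
    rw [← div_eq_mul_inv, ENNReal.le_div_iff_mul_le (Or.inl (ENNReal.ofReal_pos.2 hZF).ne')
      (Or.inl ENNReal.ofReal_ne_top)]
    exact h
  refine h1.trans ?_
  rw [mul_assoc, mul_comm Z, ← mul_assoc, ← ENNReal.ofReal_inv_of_pos hZF, ← ENNReal.ofReal_mul hC]
  gcongr
  rw [div_eq_mul_inv]
  exact mul_le_mul_of_nonneg_left ((inv_le_inv₀ hZF hf).2 hfZ) hC


/-! ### The Peierls sum -/

/-- `(2⌈1/δ⌉ + 1)² ≤ 25/δ²` for `0 < δ ≤ 1`. [folklore] -/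
theorem ceil_sq_le (hδ : 0 < δ) (hδ1 : δ ≤ 1) : ((2 * ⌈1 / δ⌉₊ + 1 : ℕ) : ℝ) ^ 2 ≤ 25 / δ ^ 2 := by
  have h3 : ((⌈1 / δ⌉₊ : ℕ) : ℝ) < 1 / δ + 1 := Nat.ceil_lt_add_one (by positivity)
  have h4 : (1 : ℝ) ≤ 1 / δ := by rw [le_div_iff₀ hδ]; linarith
  have h5 : ((2 * ⌈1 / δ⌉₊ + 1 : ℕ) : ℝ) ≤ 5 * (1 / δ) := by push_cast; linarith
  have h6 : (0 : ℝ) ≤ ((2 * ⌈1 / δ⌉₊ + 1 : ℕ) : ℝ) := by positivity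
  calc ((2 * ⌈1 / δ⌉₊ + 1 : ℕ) : ℝ) ^ 2 ≤ (5 * (1 / δ)) ^ 2 := pow_le_pow_left₀ h6 h5 2
    _ = 25 / δ ^ 2 := by field_simp; norm_num

/-- The number of deep boxes is at most `25/δ²` (`0 < δ ≤ 1`). [folklore] -/
theorem card_deepBoxes_le (hδ : 0 < δ) (hδ1 : δ ≤ 1) (m : ℕ) :
    ((deepBoxes δ m).card : ℝ) ≤ 25 / δ ^ 2 := by
  classical
  have h1 : (deepBoxes δ m).card ≤ (2 * ⌈1 / δ⌉₊ + 1) ^ 2 :=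
    (Finset.card_le_card (Finset.filter_subset _ _)).trans (by rw [card_box])
  have h2 : ((deepBoxes δ m).card : ℝ) ≤ ((2 * ⌈1 / δ⌉₊ + 1 : ℕ) : ℝ) ^ 2 := by exact_mod_cast h1
  exact h2.trans (ceil_sq_le hδ hδ1)

/-- The geometric tail of the Peierls sum: for `q ≥ 100` and `K₀ = ⌊s/C₃⌋ + 1`,
`Σ_{K₀ ≤ K ≤ K₁} 25^{K-1} · 4 · (C₇ x⁸ / q^K) ≤ (8 C₇ x⁸ / 25) e^{-(log 2 / C₃) s}`.
[cite: DuminilCopinKozmaYadin2014, §3 (proof of Theorem 6: "Σ_{i ≥ s/(2m+1)²} (λ/Z_m(x))^i ≤ … 2^{-s/(2m+1)²}")] -/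
theorem peierls_tail_le {q C₇ x : ℝ} (s C₃ : ℝ) (hq : 100 ≤ q) (hC₇ : 0 ≤ C₇) (K₁ : ℕ) :
    ∑ K ∈ Finset.Ico (⌊s / C₃⌋₊ + 1) K₁, (25 : ℝ) ^ (K - 1) * 4 * (C₇ * x ^ 8 / q ^ K) ≤
      8 * C₇ * x ^ 8 / 25 * Real.exp (-(Real.log 2 / C₃ * s)) := by
  set K₀ : ℕ := ⌊s / C₃⌋₊ + 1 with hK₀
  have hq0 : 0 < q := by linarith
  have hx8 : 0 ≤ C₇ * x ^ 8 := mul_nonneg hC₇ (by positivity)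
  -- termwise: `25^{K-1} · 4 · C₇x⁸/q^K = (4 C₇ x⁸/25) (25/q)^K ≤ (4 C₇ x⁸ / 25) (1/2)^K`
  have hterm : ∀ K ∈ Finset.Ico K₀ K₁, (25 : ℝ) ^ (K - 1) * 4 * (C₇ * x ^ 8 / q ^ K) ≤
      4 * (C₇ * x ^ 8) / 25 * (1 / 2) ^ K := by
    intro K hK
    have hK1 : K ≠ 0 := by have := (Finset.mem_Ico.1 hK).1; omega
    have h25 : (25 : ℝ) ^ (K - 1) = 25 ^ K / 25 := by
      rw [eq_div_iff (by norm_num), mul_comm, mul_pow_sub_one hK1]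
    rw [h25]
    have hratio : (25 : ℝ) ^ K / q ^ K ≤ (1 / 2) ^ K := by
      rw [← div_pow]
      exact pow_le_pow_left₀ (by positivity) (by rw [div_le_iff₀ hq0]; linarith) K
    calc (25 : ℝ) ^ K / 25 * 4 * (C₇ * x ^ 8 / q ^ K) = 4 * (C₇ * x ^ 8) / 25 * (25 ^ K / q ^ K) := by
          ring
      _ ≤ 4 * (C₇ * x ^ 8) / 25 * (1 / 2) ^ K := mul_le_mul_of_nonneg_left hratio (by positivity)
  refine (Finset.sum_le_sum hterm).trans ?_
  rw [← Finset.mul_sum]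
  have hgeom : ∑ K ∈ Finset.Ico K₀ K₁, ((1 : ℝ) / 2) ^ K ≤ 2 * (1 / 2) ^ K₀ := by
    refine (geom_sum_Ico_le_of_lt_one (by norm_num) (by norm_num)).trans_eq ?_
    norm_num; ring
  -- `(1/2)^{K₀} ≤ e^{-(log 2 / C₃) s}` since `K₀ ≥ s / C₃`
  have hexp : ((1 : ℝ) / 2) ^ K₀ ≤ Real.exp (-(Real.log 2 / C₃ * s)) := by
    have h1 : ((1 : ℝ) / 2) ^ K₀ = Real.exp (K₀ * (-Real.log 2)) := by
      rw [Real.exp_nat_mul, Real.exp_neg, Real.exp_log two_pos, one_div]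
    rw [h1, Real.exp_le_exp]
    have h2 : s / C₃ ≤ K₀ := by
      rw [hK₀]; push_cast; exact (Nat.lt_floor_add_one _).le
    have h3 : Real.log 2 / C₃ * s = Real.log 2 * (s / C₃) := by ring
    rw [h3]
    nlinarith [Real.log_pos one_lt_two]
  calc 4 * (C₇ * x ^ 8) / 25 * ∑ K ∈ Finset.Ico K₀ K₁, ((1 : ℝ) / 2) ^ K
      ≤ 4 * (C₇ * x ^ 8) / 25 * (2 * Real.exp (-(Real.log 2 / C₃ * s))) := by
        refine mul_le_mul_of_nonneg_left (hgeom.trans ?_) (by positivity)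
        linarith
    _ = 8 * C₇ * x ^ 8 / 25 * Real.exp (-(Real.log 2 / C₃ * s)) := by ring

/-- Real bookkeeping for the final constant: with `c = min(c_G, c_B/25)`, `0 < δ ≤ 1`,
`0 ≤ s < 25/δ²`: `max(C_B e^{-c_B/δ²}, 0) + (A/δ²) e^{-c_G s} ≤ ((A + max(C_B,0))/δ²) e^{-c s}`.
[folklore] -/
theorem final_constant_le {δ s cG cB CB A : ℝ} (hδ : 0 < δ) (hδ1 : δ ≤ 1) (hs : 0 ≤ s)
    (hs' : s < 25 / δ ^ 2) (hcB : 0 < cB) (hA : 0 ≤ A) :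
    max (CB * Real.exp (-(cB / δ ^ 2))) 0 + A / δ ^ 2 * Real.exp (-(cG * s)) ≤
      (A + max CB 0) / δ ^ 2 * Real.exp (-(min cG (cB / 25) * s)) := by
  set c := min cG (cB / 25) with hc
  have hδ2 : 0 < δ ^ 2 := by positivity
  have hinv : (1 : ℝ) ≤ 1 / δ ^ 2 := by
    rw [le_div_iff₀ hδ2]; nlinarith
  have hE : 0 < Real.exp (-(c * s)) := Real.exp_pos _
  -- the boundary-layer term
  have h1 : max (CB * Real.exp (-(cB / δ ^ 2))) 0 ≤ max CB 0 / δ ^ 2 * Real.exp (-(c * s)) := by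
    refine max_le ?_ (by positivity)
    have e1 : Real.exp (-(cB / δ ^ 2)) ≤ Real.exp (-(c * s)) := by
      rw [Real.exp_le_exp, neg_le_neg_iff]
      have : c * s ≤ cB / 25 * s := mul_le_mul_of_nonneg_right (min_le_right _ _) hs
      have : cB / 25 * s ≤ cB / δ ^ 2 := by
        rw [div_mul_eq_mul_div, div_le_div_iff₀ (by norm_num) hδ2]
        have := hs'.le
        rw [lt_div_iff₀ hδ2] at hs'
        nlinarith
      linarith
    calc CB * Real.exp (-(cB / δ ^ 2)) ≤ max CB 0 * Real.exp (-(cB / δ ^ 2)) :=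
          mul_le_mul_of_nonneg_right (le_max_left _ _) (Real.exp_pos _).le
      _ ≤ max CB 0 * Real.exp (-(c * s)) := mul_le_mul_of_nonneg_left e1 (le_max_right _ _)
      _ ≤ max CB 0 / δ ^ 2 * Real.exp (-(c * s)) := by
          refine mul_le_mul_of_nonneg_right ?_ hE.le
          calc max CB 0 = max CB 0 * 1 := (mul_one _).symm
            _ ≤ max CB 0 * (1 / δ ^ 2) := mul_le_mul_of_nonneg_left hinv (le_max_right _ _)
            _ = max CB 0 / δ ^ 2 := mul_one_div _ _
  -- the Peierls term
  have h2 : A / δ ^ 2 * Real.exp (-(cG * s)) ≤ A / δ ^ 2 * Real.exp (-(c * s)) := by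
    refine mul_le_mul_of_nonneg_left ?_ (by positivity)
    rw [Real.exp_le_exp, neg_le_neg_iff]
    exact mul_le_mul_of_nonneg_right (min_le_left _ _) hs
  calc max (CB * Real.exp (-(cB / δ ^ 2))) 0 + A / δ ^ 2 * Real.exp (-(cG * s))
      ≤ max CB 0 / δ ^ 2 * Real.exp (-(c * s)) + A / δ ^ 2 * Real.exp (-(c * s)) := add_le_add h1 h2
    _ = (A + max CB 0) / δ ^ 2 * Real.exp (-(c * s)) := by ring

end SupercriticalSAW

end Literature.Barriers.CriticalPhenomena
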